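import Summits.QuantumFields.BalabanUV.T4Continuum.Support.T4TrajectoryDensityGated

/-!
# `T4Continuum.T4TrajectoryDensityPerWindow` — THE (N2) WINDOW GUARD RE-CUT PER STEP: the gated per-family capstone of
# `T4TrajectoryDensityGated` with the chart-motion nesting `hN2` asked only for directions of declared bound `≤ wk b k′ (k+1)`
# — a PER-GENERATION, PER-STEP chart window `wk b k′ k ≤ w` (non-increasing in `k`, above the booked defect and the
# fluctuation diameter) — instead of the uniform `≤ w` (cell `pub-balaban`, sub-cell `t4`, spine estimate NE1′ (node O3b/H2);
# NE1′ formalisation swarm `b2b-balaban-t4-ne1p-formalise-*`, leaf prover 08, own-initiative SUPPLIER item «R-b» of the located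
# finding F-ne1pleaf08-1, HOME/CLAIMS.log l.8748; tree target `Summits/QuantumFields/BalabanUV/T4Continuum/Support/`; ADDITIVE —
# imports `T4TrajectoryDensityGated` ONLY; a parallel `_win` chain over `T4TrajectoryModulus` ∕ `T4TrajectoryDensity` BY NAME;
# modifies nothing)

HONEST FRAMING.  Finite four-torus, rung (B)+1 only — NOT infinite volume, NOT a mass gap, NOT the Clay problem, NOT summit
progress.  «continuum YM on T⁴ ⇐ BetaPertH ∧ nine spine estimates (0/9 proved); BetaPertH ⇐ (D1) ∧ (D4) ∧ CAP+tail; G-an2-4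
gates asym, D1 and NE2/3/4».  [folklore] kernel glue (the lineage's own proofs re-run with one extra index), 0 sorry, 0 citations;
nothing of Bałaban's densities or the cell's D-terms is asserted — births, the step law, the action binders, the window geometry,
the defects and their rate stay binders ((w1), H2, (w2-act), (w3)⁺, (I4′)).

WHY (finding F-ne1pleaf08-1, (4)).  In the lineage's chain the nesting binder (N2)
`hN2 : ∀ U₀ ∈ 𝒦 b k′ (k+1), ∀ p, latN p ≤ w → ∀ z′ ∈ D b k, latMove U₀ p 1 + z′ ∈ 𝒦 b k′ k` is USED only through
`T4TrajectoryModulus.hpair_add`, at directions `p` with `latN p ≤ δ` where `δ` is the defect of a WINDOWED raw pair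
(`Windowed (RawAdm …) w`, guard `δ ≤ w`) — and the pairs that matter have defect `defect b k′ k ≤ c_δψ^{k−k′}`.  Asked for ALL
`latN p ≤ w`, (N2) makes the window of step `k` absorb the window of step `k+1` FATTENED BY `w`: along a family's life the birth
window must absorb `K·w` (row S1's `WindowSchedule.window_budget`, p212498) — a cutoff-dependent demand on the birth binder (w1),
i.e. on `UniformConstants` (trigger caveat k1).  Re-cutting the guard to a per-step window `wk b k′ k` with
`defect b k′ k ≤ wk b k′ k`, `θ b k ≤ wk b k′ k ≤ w`, `wk b k′ (k+1) ≤ wk b k′ k` changes NO constant and NO conclusion, and the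
consumption becomes `Σ_k wk b k′ k` — summable for the geometric windows the cell reads in the birth frame («for a unit scale-`k`
fluctuation read in the `j`-frame, `N d = O(L^{−(k−j)})`», `T4BirthChartTransport.slice_bound`).

CONTENTS (§23 of the (w2)-split numbering).
* `contStepLawOn_of_opSlice_windowed₂` — `T4TrajectoryModulus.contStepLawOn_of_opSlice_windowed` with the UPPER pairs windowed at
  any `w₁` (the action binders `hcov`/`hpair` guarded by `δ ≤ w₁`) and an arbitrary lower admissibility; same fields.
* `transportsFromVar_of_opSlices_fam_win` — `transportsFromVar_of_opSlices_fam` with `Adm b k′ k := Windowed (RawAdm …) (wk b k′ k)`.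
* `transportsFromVar_of_linearOpSlicesOn_fam_win`, `transportsFromVar_of_linearOpSlicesOn_lattice_fam_win` (here `hN2` carries the
  guard `latN p ≤ wk b k′ (k+1)`; `hpair_add (w := wk b k′ (k+1))` by name), and the dressed-centred gated capstone
  **`transportsFromVar_of_centredExponent_lattice_fam_gated_win`** — `T4TrajectoryDensityGated`'s
  `transportsFromVar_of_centredExponent_lattice_fam_gated` VERBATIM except `hN2` (re-cut) and the three window binders
  `hwk : wk ≤ w`, `hwk_anti : wk b k′ (k+1) ≤ wk b k′ k`, `hdefwk : defect b k′ k ≤ wk b k′ k`, `hθwk : θ b k ≤ wk b k′ k`;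
  SAME conclusion `T.TransportsFromVar (4c_δ/r) (fun i => ψ·α i) Gate`.  The Spine face (END-F-win, `Gate := budgetGate`) is
  `Spine/NE1p/DressedRootWin.lean`.
-/

namespace Summit.QuantumFields.BalabanUV.T4Continuum.T4TrajectoryDensityDressed

open MeasureTheory Set Metric Filter
open Literature.MathematicalPhysics.QuantumFieldTheory.Balaban1983to89
open T4TermFormat T4TermFormat.Booking T4GatedBooking T4TrajectoryComparison T4TrajectoryModulus
open T4BirthChartTransport (GaugeInvariant BirthSlice RelGauge)
open T4BlockTransport (Fld NDir latMove latN latMove_zero)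
open T4TrajectoryDensity

noncomputable section

/-! ## §23a The step law with the upper pairs windowed at their own guard [folklore] -/

section StepLaw

variable {𝒰 Dir F : Type*} [NormedAddCommGroup F] [NormedSpace ℂ F] [CompleteSpace F]
  {move : 𝒰 → Dir → ℂ → 𝒰} {N : Dir → ℝ} {w : ℝ}

/-- **THE STEP LAW FROM THE OPERATION'S SLICES, UPPER PAIRS WINDOWED AT `w₁`** — `contStepLawOn_of_opSlice_windowed` VERBATIM
except that the upper raw pairs carry their OWN guard `δ ≤ w₁` (any `w₁`; the action binders `hcov`/`hpair` are asked only under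
it) and the lower admissibility `Adm'` is arbitrary (the caller windows it at the next guard).  `hsup`/`hEsl`/`bgLip_of_opSlice`
exactly as in §H/§K; `ω ≤ w` is still the law's window (the range on which moduli are tested). [folklore] -/
theorem contStepLawOn_of_opSlice_windowed₂ {Z : Type*} {𝒢 : Set (Z → F)} {E : 𝒰 → (Z → F) → F}
    {act : Z → 𝒰 → 𝒰} {D : Set Z} {𝒦 : Set 𝒰} {Adm' : 𝒰 → 𝒰 → ℝ → Prop} {ϱ a ω w₁ : ℝ}
    (hD : D.Nonempty) (hϱ : 0 < ϱ) (hmove : ∀ U d, move U d 0 = U)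
    (hsup : ∀ U₀ ∈ 𝒦, ∀ g ∈ 𝒢, ∀ g' ∈ 𝒢, ∀ (m : ℝ), (∀ z ∈ D, ‖g z - g' z‖ ≤ m) → ‖E U₀ g - E U₀ g'‖ ≤ a * m)
    (hEsl : ∀ g ∈ 𝒢, ∀ (c : F) (m : ℝ), (∀ z ∈ D, ‖g z - c‖ ≤ m) →
      BirthSlice (fun U => E U g - c) move N 𝒦 w ϱ (a * m))
    (hcov : ∀ (U₀ U₁ : 𝒰) (δ : ℝ), RawAdm move N 𝒦 U₀ U₁ δ → δ ≤ w₁ → ∀ z ∈ D, Adm' (act z U₀) (act z U₁) δ)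
    (hpair : ∀ (U₀ U₁ : 𝒰) (δ : ℝ), RawAdm move N 𝒦 U₀ U₁ δ → δ ≤ w₁ → ∀ z ∈ D, ∀ z' ∈ D, z ≠ z' →
      Adm' (act z' U₁) (act z U₁) ω)
    (hω0 : 0 ≤ ω) (hωw : ω ≤ w) :
    ContStepLawOn 𝒢 E act D (Windowed (RawAdm move N 𝒦) w₁) Adm' w a (4 * a / ϱ) ω where
  supCost := fun U₀ _ _ hadm _ g hg g' hg' m hm => hsup U₀ hadm.1.1 g hg g' hg' m hm
  bgLip := fun U₀ U₁ δ hadm hδ => bgLip_of_opSlice hD hϱ hmove hEsl U₀ U₁ δ hadm.1 hδ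
  covariant := fun U₀ U₁ δ hadm => hcov U₀ U₁ δ hadm.1 hadm.2
  fluctPair := fun U₀ U₁ δ hadm => hpair U₀ U₁ δ hadm.1 hadm.2
  ω_nonneg := hω0
  ω_le := hωw

end StepLaw

/-! ## §23b The per-family pipeline with per-step chart windows [folklore] -/

section PerWindowAbstract

variable {B : Booking} {T : Trajectory B}
variable {𝒰 Dir F : Type*} [NormedAddCommGroup F] [NormedSpace ℂ F] [CompleteSpace F]
variable {move : 𝒰 → Dir → ℂ → 𝒰} {w r : ℝ}

/-- **THE WINDOW-GUARDED PIPELINE FROM OPERATOR SLICES, PER FAMILY, PER-STEP WINDOWS** — `transportsFromVar_of_opSlices_fam`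
VERBATIM except that the admissible pairs of generation `(b, k′)` at scale `k` are the raw pairs windowed at `wk b k′ k`
(`Windowed (RawAdm …) (wk b k′ k)` in `transportsFromVar_of_moduli_dep`), so the two action binders are asked only for upper
pairs of defect `δ ≤ wk b k′ (k+1)`: `hcov` must land in defect `δ ≤ wk b k′ k` (hence `hwk_anti`), `hpair`'s fluctuation pair has
defect `ω b k′ k ≤ wk b k′ k`; the attaining pair has defect `defect b k′ k ≤ wk b k′ k` (`hdefwk`); `wk ≤ w` keeps every tested
defect inside the moduli's range.  SAME conclusion. [folklore] -/
theorem transportsFromVar_of_opSlices_fam_win {Z : Type*} {Gate : ℕ → Prop} {Fn : B.Birth → ℕ → ℕ → 𝒰 → F}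
    {rel : B.Birth → ℕ → ℕ → 𝒰 → 𝒰 → Prop} {Nk : B.Birth → ℕ → ℕ → Dir → ℝ} {𝒦 : B.Birth → ℕ → ℕ → Set 𝒰}
    {𝒢 : B.Birth → ℕ → Set (Z → F)} {E : B.Birth → ℕ → 𝒰 → (Z → F) → F} {act : B.Birth → ℕ → Z → 𝒰 → 𝒰}
    {D : B.Birth → ℕ → Set Z} {defect wk : B.Birth → ℕ → ℕ → ℝ} {cδ ψ : ℝ} {a : B.Birth → ℕ → ℝ} {α : ℕ → ℝ}
    {ϱ ω : B.Birth → ℕ → ℕ → ℝ}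
    (hα : ∀ i, 0 ≤ α i) (hr : 0 < r) (hmove : ∀ U d, move U d 0 = U)
    (hsl : ∀ (b : B.Birth) (k' : ℕ), B.birthScale b ≤ k' → k' ≤ B.K → RanBelow Gate k' →
      BirthSlice (Fn b k' k') move (Nk b k' k') (𝒦 b k' k') w r (T.gen b k'))
    (hFn : ∀ (b : B.Birth) (k' k : ℕ), B.birthScale b ≤ k' → k' ≤ k → k + 1 ≤ B.K → RanBelow Gate (k + 1) →
      ∀ U, Fn b k' (k + 1) U = E b k U (fun z => Fn b k' k (act b k z U)))
    (h𝒢 : ∀ (b : B.Birth) (k' k : ℕ), B.birthScale b ≤ k' → k' ≤ k → k + 1 ≤ B.K → RanBelow Gate (k + 1) →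
      ∀ U, (fun z => Fn b k' k (act b k z U)) ∈ 𝒢 b k)
    (hD : ∀ b k, (D b k).Nonempty) (hϱ : ∀ b k' k, 0 < ϱ b k' k)
    (hsup : ∀ (b : B.Birth) (k' k : ℕ), B.birthScale b ≤ k' → k' ≤ k → k + 1 ≤ B.K → RanBelow Gate (k + 1) →
      ∀ U₀ ∈ 𝒦 b k' (k + 1), ∀ g ∈ 𝒢 b k, ∀ g' ∈ 𝒢 b k, ∀ (m : ℝ), (∀ z ∈ D b k, ‖g z - g' z‖ ≤ m) →
        ‖E b k U₀ g - E b k U₀ g'‖ ≤ a b k * m)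
    (hEsl : ∀ (b : B.Birth) (k' k : ℕ), B.birthScale b ≤ k' → k' ≤ k → k + 1 ≤ B.K → RanBelow Gate (k + 1) →
      ∀ g ∈ 𝒢 b k, ∀ (c : F) (m : ℝ), (∀ z ∈ D b k, ‖g z - c‖ ≤ m) →
        BirthSlice (fun U => E b k U g - c) move (Nk b k' (k + 1)) (𝒦 b k' (k + 1)) w (ϱ b k' k) (a b k * m))
    (hcov : ∀ (b : B.Birth) (k' k : ℕ), B.birthScale b ≤ k' → k' ≤ k → k + 1 ≤ B.K → RanBelow Gate (k + 1) →
      ∀ (U₀ U₁ : 𝒰) (δ : ℝ), RawAdm move (Nk b k' (k + 1)) (𝒦 b k' (k + 1)) U₀ U₁ δ → δ ≤ wk b k' (k + 1) →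
        ∀ z ∈ D b k, RawAdm move (Nk b k' k) (𝒦 b k' k) (act b k z U₀) (act b k z U₁) δ)
    (hpair : ∀ (b : B.Birth) (k' k : ℕ), B.birthScale b ≤ k' → k' ≤ k → k + 1 ≤ B.K → RanBelow Gate (k + 1) →
      ∀ (U₀ U₁ : 𝒰) (δ : ℝ), RawAdm move (Nk b k' (k + 1)) (𝒦 b k' (k + 1)) U₀ U₁ δ → δ ≤ wk b k' (k + 1) →
        ∀ z ∈ D b k, ∀ z' ∈ D b k, z ≠ z' →
          RawAdm move (Nk b k' k) (𝒦 b k' k) (act b k z' U₁) (act b k z U₁) (ω b k' k))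
    (hω : ∀ b k' k, 0 ≤ ω b k' k ∧ ω b k' k ≤ wk b k' k)
    (hwk : ∀ b k' k, wk b k' k ≤ w) (hwk_anti : ∀ b k' k, wk b k' (k + 1) ≤ wk b k' k)
    (hdom : ∀ (b : B.Birth) (k' k : ℕ), B.birthScale b ≤ k' → k' ≤ k → k + 1 ≤ B.K →
      a b k * (1 + 4 * ω b k' k / ϱ b k' k) ≤ α k)
    (hinv : ∀ b k' k, GaugeInvariant (rel b k' k) (Fn b k' k))
    (hdefwk : ∀ b k' k, defect b k' k ≤ wk b k' k)
    (hrate : ∀ (b : B.Birth) (k' k : ℕ), B.birthScale b ≤ k' → k' ≤ k → k ≤ B.K →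
      defect b k' k ≤ cδ * ψ ^ (k - k'))
    (hlin : ∀ (b : B.Birth) (k' k : ℕ), B.birthScale b ≤ k' → k' ≤ k → k ≤ B.K → RanBelow Gate k → ∀ ε > 0,
      ∃ U₀ ∈ 𝒦 b k' k, ∃ U₁ : 𝒰, RelGauge (rel b k' k) move (Nk b k' k) U₀ U₁ (defect b k' k) ∧
        T.lin b k' k ≤ ‖Fn b k' k U₁ - Fn b k' k U₀‖ + ε) :
    T.TransportsFromVar (4 * cδ / r) (fun i => ψ * α i) Gate := by
  have h := transportsFromVar_of_moduli_dep (T := T) (C₀ := 4 / r)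
    (Adm := fun b k' k => Windowed (RawAdm move (Nk b k' k) (𝒦 b k' k)) (wk b k' k)) (by positivity) hα
    (fun b k' hbk' hk hran =>
      ((respMod_raw_of_birthSlice (hsl b k' hbk' hk hran) hmove hr (T.gen_nonneg b k')).congr_const
        (by ring)).of_imp fun _ _ _ hadm => hadm.1)
    (cont_of_contStepLawOn_fam (Adm := fun b k' k => Windowed (RawAdm move (Nk b k' k) (𝒦 b k' k)) (wk b k' k))
      (𝒢 := 𝒢) (D := D) (ℓ := fun b k' k => 4 * a b k / ϱ b k' k) (ω := ω)
      (fun b k' k U₀ U₁ δ hadm => rawAdm_nonneg hadm.1) hFn h𝒢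
      (fun b k' k hbk' hk'k hk hran => contStepLawOn_of_opSlice_windowed₂ (hD b k) (hϱ b k' k) hmove
        (hsup b k' k hbk' hk'k hk hran) (hEsl b k' k hbk' hk'k hk hran)
        (fun U₀ U₁ δ hadm hδ z hz =>
          ⟨hcov b k' k hbk' hk'k hk hran U₀ U₁ δ hadm hδ z hz, hδ.trans (hwk_anti b k' k)⟩)
        (fun U₀ U₁ δ hadm hδ z hz z' hz' hzz =>
          ⟨hpair b k' k hbk' hk'k hk hran U₀ U₁ δ hadm hδ z hz z' hz' hzz, (hω b k' k).2⟩)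
        (hω b k' k).1 ((hω b k' k).2.trans (hwk b k' k)))
      (fun b k' k hbk' hk'k hk => by
        show a b k + 4 * a b k / ϱ b k' k * ω b k' k ≤ α k
        rw [stepFactor_eq]
        exact hdom b k' k hbk' hk'k hk))
    (fun b k' k => (hdefwk b k' k).trans (hwk b k' k)) hrate
    (fun b k' k hbk' hk'k hk hran ε hε => by
      obtain ⟨U₀, hU₀, U₁, ⟨dd, hd, hdδ, hrel⟩, hle⟩ := hlin b k' k hbk' hk'k hk hran ε hε
      refine ⟨U₀, move U₀ dd 1, ⟨⟨hU₀, dd, hd, hdδ, rfl⟩, hdefwk b k' k⟩, ?_⟩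
      rwa [hinv b k' k _ _ hrel] at hle)
  have e : 4 / r * cδ = 4 * cδ / r := by ring
  rw [e] at h
  exact h

/-- **THE CLASS-GUARDED LINEAR-OPERATION PIPELINE, PER FAMILY, PER-STEP WINDOWS** — `transportsFromVar_of_linearOpSlicesOn_fam`
VERBATIM with the per-step windows of `transportsFromVar_of_opSlices_fam_win` (`hsup`/`hEsl` from the operator slice `hop` by
`supCost_of_opSliceOn` ∕ `opSliceOn_centred`). [folklore] -/
theorem transportsFromVar_of_linearOpSlicesOn_fam_win {Z : Type*} {Gate : ℕ → Prop} {Fn : B.Birth → ℕ → ℕ → 𝒰 → F}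
    {rel : B.Birth → ℕ → ℕ → 𝒰 → 𝒰 → Prop} {Nk : B.Birth → ℕ → ℕ → Dir → ℝ} {𝒦 : B.Birth → ℕ → ℕ → Set 𝒰}
    {𝒢 : B.Birth → ℕ → Set (Z → F)} {E : B.Birth → ℕ → 𝒰 → (Z → F) → F} {act : B.Birth → ℕ → Z → 𝒰 → 𝒰}
    {D : B.Birth → ℕ → Set Z} {defect wk : B.Birth → ℕ → ℕ → ℝ} {cδ ψ : ℝ} {a : B.Birth → ℕ → ℝ} {α : ℕ → ℝ}
    {ϱ ω : B.Birth → ℕ → ℕ → ℝ}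
    (hα : ∀ i, 0 ≤ α i) (hr : 0 < r) (hmove : ∀ U d, move U d 0 = U)
    (hsl : ∀ (b : B.Birth) (k' : ℕ), B.birthScale b ≤ k' → k' ≤ B.K → RanBelow Gate k' →
      BirthSlice (Fn b k' k') move (Nk b k' k') (𝒦 b k' k') w r (T.gen b k'))
    (hFn : ∀ (b : B.Birth) (k' k : ℕ), B.birthScale b ≤ k' → k' ≤ k → k + 1 ≤ B.K → RanBelow Gate (k + 1) →
      ∀ U, Fn b k' (k + 1) U = E b k U (fun z => Fn b k' k (act b k z U)))
    (h𝒢 : ∀ (b : B.Birth) (k' k : ℕ), B.birthScale b ≤ k' → k' ≤ k → k + 1 ≤ B.K → RanBelow Gate (k + 1) →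
      ∀ U, (fun z => Fn b k' k (act b k z U)) ∈ 𝒢 b k)
    (hD : ∀ b k, (D b k).Nonempty) (hϱ : ∀ b k' k, 0 < ϱ b k' k)
    (h𝒢c : ∀ (b : B.Birth) (k : ℕ) (c : F), (fun _ : Z => c) ∈ 𝒢 b k)
    (h𝒢s : ∀ (b : B.Birth) (k : ℕ), ∀ g ∈ 𝒢 b k, ∀ g' ∈ 𝒢 b k, g - g' ∈ 𝒢 b k)
    (hsub : ∀ (b : B.Birth) (k : ℕ) (U : 𝒰), ∀ g ∈ 𝒢 b k, ∀ g' ∈ 𝒢 b k, E b k U (g - g') = E b k U g - E b k U g')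
    (hnorm : ∀ (b : B.Birth) (k : ℕ) (U : 𝒰) (c : F), E b k U (fun _ => c) = c)
    (hop : ∀ (b : B.Birth) (k' k : ℕ), B.birthScale b ≤ k' → k' ≤ k → k + 1 ≤ B.K → RanBelow Gate (k + 1) →
      OpSliceOn (𝒢 b k) (E b k) (D b k) move (Nk b k' (k + 1)) (𝒦 b k' (k + 1)) w (ϱ b k' k) (a b k))
    (hdir : ∀ (b : B.Birth) (k' k : ℕ), B.birthScale b ≤ k' → k' ≤ k → k + 1 ≤ B.K →
      ∃ d : Dir, 0 < Nk b k' (k + 1) d ∧ Nk b k' (k + 1) d ≤ w)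
    (hcov : ∀ (b : B.Birth) (k' k : ℕ), B.birthScale b ≤ k' → k' ≤ k → k + 1 ≤ B.K → RanBelow Gate (k + 1) →
      ∀ (U₀ U₁ : 𝒰) (δ : ℝ), RawAdm move (Nk b k' (k + 1)) (𝒦 b k' (k + 1)) U₀ U₁ δ → δ ≤ wk b k' (k + 1) →
        ∀ z ∈ D b k, RawAdm move (Nk b k' k) (𝒦 b k' k) (act b k z U₀) (act b k z U₁) δ)
    (hpair : ∀ (b : B.Birth) (k' k : ℕ), B.birthScale b ≤ k' → k' ≤ k → k + 1 ≤ B.K → RanBelow Gate (k + 1) →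
      ∀ (U₀ U₁ : 𝒰) (δ : ℝ), RawAdm move (Nk b k' (k + 1)) (𝒦 b k' (k + 1)) U₀ U₁ δ → δ ≤ wk b k' (k + 1) →
        ∀ z ∈ D b k, ∀ z' ∈ D b k, z ≠ z' →
          RawAdm move (Nk b k' k) (𝒦 b k' k) (act b k z' U₁) (act b k z U₁) (ω b k' k))
    (hω : ∀ b k' k, 0 ≤ ω b k' k ∧ ω b k' k ≤ wk b k' k)
    (hwk : ∀ b k' k, wk b k' k ≤ w) (hwk_anti : ∀ b k' k, wk b k' (k + 1) ≤ wk b k' k)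
    (hdom : ∀ (b : B.Birth) (k' k : ℕ), B.birthScale b ≤ k' → k' ≤ k → k + 1 ≤ B.K →
      a b k * (1 + 4 * ω b k' k / ϱ b k' k) ≤ α k)
    (hinv : ∀ b k' k, GaugeInvariant (rel b k' k) (Fn b k' k))
    (hdefwk : ∀ b k' k, defect b k' k ≤ wk b k' k)
    (hrate : ∀ (b : B.Birth) (k' k : ℕ), B.birthScale b ≤ k' → k' ≤ k → k ≤ B.K →
      defect b k' k ≤ cδ * ψ ^ (k - k'))
    (hlin : ∀ (b : B.Birth) (k' k : ℕ), B.birthScale b ≤ k' → k' ≤ k → k ≤ B.K → RanBelow Gate k → ∀ ε > 0,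
      ∃ U₀ ∈ 𝒦 b k' k, ∃ U₁ : 𝒰, RelGauge (rel b k' k) move (Nk b k' k) U₀ U₁ (defect b k' k) ∧
        T.lin b k' k ≤ ‖Fn b k' k U₁ - Fn b k' k U₀‖ + ε) :
    T.TransportsFromVar (4 * cδ / r) (fun i => ψ * α i) Gate :=
  transportsFromVar_of_opSlices_fam_win hα hr hmove hsl hFn h𝒢 hD hϱ
    (fun b k' k hbk' hk'k hk hran =>
      supCost_of_opSliceOn (h𝒢s b k) (hsub b k) (hop b k' k hbk' hk'k hk hran) hmove (hϱ b k' k).le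
        (hdir b k' k hbk' hk'k hk))
    (fun b k' k hbk' hk'k hk hran =>
      opSliceOn_centred (h𝒢c b k) (h𝒢s b k) (hsub b k) (hnorm b k) (hop b k' k hbk' hk'k hk hran))
    hcov hpair hω hwk hwk_anti hdom hinv hdefwk hrate hlin

end PerWindowAbstract

/-! ## §23c On `ℤ^d`: (N2) guarded by the next step's window; the gated dressed-centred capstone [folklore] -/

section PerWindowLattice

variable {B : Booking} {T : Trajectory B}
variable {R : Type*} [NormedRing R] [NormedAlgebra ℂ R] {d : ℕ}
  {F : Type*} [NormedAddCommGroup F] [NormedSpace ℂ F] [CompleteSpace F]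

/-- **ON `ℤ^d`, PER FAMILY, PER-STEP WINDOWS** — `transportsFromVar_of_linearOpSlicesOn_lattice_fam` VERBATIM except that the
nesting binder (N2) is asked only for chart motions of declared bound `≤ wk b k′ (k+1)`:
`hN2 : ∀ U₀ ∈ 𝒦 b k′ (k+1), ∀ p, latN p ≤ wk b k′ (k+1) → ∀ z′ ∈ D b k, latMove U₀ p 1 + z′ ∈ 𝒦 b k′ k`
(`hpair_add (w := wk b k′ (k+1))` by name), with the window binders `hwk`/`hwk_anti`/`hdefwk` and the fluctuation diameter
below the window, `θ b k ≤ wk b k′ k` (`hθwk`). [folklore] -/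
theorem transportsFromVar_of_linearOpSlicesOn_lattice_fam_win {Gate : ℕ → Prop} {Fn : B.Birth → ℕ → ℕ → Fld d R → F}
    {rel : B.Birth → ℕ → ℕ → Fld d R → Fld d R → Prop} {𝒦 : B.Birth → ℕ → ℕ → Set (Fld d R)}
    {𝒢 : B.Birth → ℕ → Set (Fld d R → F)} {E : B.Birth → ℕ → Fld d R → (Fld d R → F) → F}
    {D : B.Birth → ℕ → Set (Fld d R)} {defect wk : B.Birth → ℕ → ℕ → ℝ} {cδ ψ w r : ℝ}
    {a θ : B.Birth → ℕ → ℝ} {α : ℕ → ℝ} {ϱ : B.Birth → ℕ → ℕ → ℝ}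
    (hα : ∀ i, 0 ≤ α i) (hr : 0 < r) (hw : 0 < w)
    (hsl : ∀ (b : B.Birth) (k' : ℕ), B.birthScale b ≤ k' → k' ≤ B.K → RanBelow Gate k' →
      BirthSlice (Fn b k' k') latMove latN (𝒦 b k' k') w r (T.gen b k'))
    (hFn : ∀ (b : B.Birth) (k' k : ℕ), B.birthScale b ≤ k' → k' ≤ k → k + 1 ≤ B.K → RanBelow Gate (k + 1) →
      ∀ U, Fn b k' (k + 1) U = E b k U (fun z => Fn b k' k (U + z)))
    (h𝒢 : ∀ (b : B.Birth) (k' k : ℕ), B.birthScale b ≤ k' → k' ≤ k → k + 1 ≤ B.K → RanBelow Gate (k + 1) →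
      ∀ U, (fun z => Fn b k' k (U + z)) ∈ 𝒢 b k)
    (hD : ∀ b k, (D b k).Nonempty) (hϱ : ∀ b k' k, 0 < ϱ b k' k)
    (h𝒢c : ∀ (b : B.Birth) (k : ℕ) (c : F), (fun _ : Fld d R => c) ∈ 𝒢 b k)
    (h𝒢s : ∀ (b : B.Birth) (k : ℕ), ∀ g ∈ 𝒢 b k, ∀ g' ∈ 𝒢 b k, g - g' ∈ 𝒢 b k)
    (hsub : ∀ (b : B.Birth) (k : ℕ) (U : Fld d R), ∀ g ∈ 𝒢 b k, ∀ g' ∈ 𝒢 b k,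
      E b k U (g - g') = E b k U g - E b k U g')
    (hnorm : ∀ (b : B.Birth) (k : ℕ) (U : Fld d R) (c : F), E b k U (fun _ => c) = c)
    (hop : ∀ (b : B.Birth) (k' k : ℕ), B.birthScale b ≤ k' → k' ≤ k → k + 1 ≤ B.K → RanBelow Gate (k + 1) →
      OpSliceOn (𝒢 b k) (E b k) (D b k) latMove latN (𝒦 b k' (k + 1)) w (ϱ b k' k) (a b k))
    (hN1 : ∀ (b : B.Birth) (k' k : ℕ), B.birthScale b ≤ k' → k' ≤ k → k + 1 ≤ B.K →
      ∀ z ∈ D b k, ∀ U ∈ 𝒦 b k' (k + 1), U + z ∈ 𝒦 b k' k)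
    (hN2 : ∀ (b : B.Birth) (k' k : ℕ), B.birthScale b ≤ k' → k' ≤ k → k + 1 ≤ B.K →
      ∀ U₀ ∈ 𝒦 b k' (k + 1), ∀ p : NDir d R, latN p ≤ wk b k' (k + 1) → ∀ z' ∈ D b k,
        latMove U₀ p 1 + z' ∈ 𝒦 b k' k)
    (hdiam : ∀ b k, ∀ z ∈ D b k, ∀ z' ∈ D b k, ∀ x ν, ‖z x ν - z' x ν‖ ≤ θ b k)
    (hθ : ∀ b k, 0 < θ b k ∧ θ b k ≤ w) (hθwk : ∀ b k' k, θ b k ≤ wk b k' k)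
    (hwk : ∀ b k' k, wk b k' k ≤ w) (hwk_anti : ∀ b k' k, wk b k' (k + 1) ≤ wk b k' k)
    (hdom : ∀ (b : B.Birth) (k' k : ℕ), B.birthScale b ≤ k' → k' ≤ k → k + 1 ≤ B.K →
      a b k * (1 + 4 * θ b k / ϱ b k' k) ≤ α k)
    (hinv : ∀ b k' k, GaugeInvariant (rel b k' k) (Fn b k' k))
    (hdefwk : ∀ b k' k, defect b k' k ≤ wk b k' k)
    (hrate : ∀ (b : B.Birth) (k' k : ℕ), B.birthScale b ≤ k' → k' ≤ k → k ≤ B.K →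
      defect b k' k ≤ cδ * ψ ^ (k - k'))
    (hlin : ∀ (b : B.Birth) (k' k : ℕ), B.birthScale b ≤ k' → k' ≤ k → k ≤ B.K → RanBelow Gate k → ∀ ε > 0,
      ∃ U₀ ∈ 𝒦 b k' k, ∃ U₁ : Fld d R, RelGauge (rel b k' k) latMove latN U₀ U₁ (defect b k' k) ∧
        T.lin b k' k ≤ ‖Fn b k' k U₁ - Fn b k' k U₀‖ + ε) :
    T.TransportsFromVar (4 * cδ / r) (fun i => ψ * α i) Gate :=
  transportsFromVar_of_linearOpSlicesOn_fam_win (act := fun _ _ z U => U + z) (Nk := fun _ _ _ => latN)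
    (ϱ := ϱ) (ω := fun b _ k => θ b k) hα hr latMove_zero hsl hFn h𝒢 hD hϱ h𝒢c h𝒢s hsub hnorm hop
    (fun _ _ _ _ _ _ => hdir_lattice hw)
    (fun b k' k hbk' hk'k hk _ U₀ U₁ δ hadm _ z hz => hcov_add (hN1 b k' k hbk' hk'k hk) U₀ U₁ δ hadm z hz)
    (fun b k' k hbk' hk'k hk _ => hpair_add (hθ b k).1 (hdiam b k) (hN2 b k' k hbk' hk'k hk))
    (fun b k' k => ⟨(hθ b k).1.le, hθwk b k' k⟩) hwk hwk_anti hdom hinv hdefwk hrate hlin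

variable [MeasurableSpace R]

/-- **THE PER-FAMILY CENTRED CAPSTONE, BUDGET UNDER THE HISTORY, PER-STEP WINDOWS** —
`T4TrajectoryDensityGated.transportsFromVar_of_centredExponent_lattice_fam_gated` VERBATIM except the nesting binder (N2), re-cut
to chart motions of declared bound `≤ wk b k′ (k+1)`, and the window binders `hwk : wk ≤ w`, `hwk_anti` (non-increasing in the
step), `hdefwk : defect b k′ k ≤ wk b k′ k`, `hθwk : θ b k ≤ wk b k′ k`.  SAME conclusion
`T.TransportsFromVar (4c_δ/r) (fun i => ψ·α i) Gate`; same constants; `hs` under `RanBelow Gate (k+1)`, domination with `e³`. [folklore] -/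
theorem transportsFromVar_of_centredExponent_lattice_fam_gated_win {Gate : ℕ → Prop}
    {Fn : B.Birth → ℕ → ℕ → Fld d R → F}
    {rel : B.Birth → ℕ → ℕ → Fld d R → Fld d R → Prop} {𝒦 : B.Birth → ℕ → ℕ → Set (Fld d R)}
    {ref : B.Birth → ℕ → Fld d R → Fld d R} {base : B.Birth → ℕ → Fld d R → ℝ}
    {𝒜 𝒬 : B.Birth → ℕ → Fld d R → Fld d R → ℂ} {q : B.Birth → ℕ → Fld d R → ℂ}
    {μ : B.Birth → ℕ → Measure (Fld d R)} {z₀ : B.Birth → ℕ → Fld d R} {D : B.Birth → ℕ → Set (Fld d R)}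
    {defect wk : B.Birth → ℕ → ℕ → ℝ} {cδ ψ w r : ℝ} {s s₁ θ : B.Birth → ℕ → ℝ} {α : ℕ → ℝ}
    {ϱ : B.Birth → ℕ → ℕ → ℝ}
    (hα : ∀ i, 0 ≤ α i) (hr : 0 < r) (hw : 0 < w)
    (hsl : ∀ (b : B.Birth) (k' : ℕ), B.birthScale b ≤ k' → k' ≤ B.K → RanBelow Gate k' →
      BirthSlice (Fn b k' k') latMove latN (𝒦 b k' k') w r (T.gen b k'))
    (hFn : ∀ (b : B.Birth) (k' k : ℕ), B.birthScale b ≤ k' → k' ≤ k → k + 1 ≤ B.K → RanBelow Gate (k + 1) →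
      ∀ U, Fn b k' (k + 1) U =
        wOp (expWeight (base b k) (𝒜 b k + 𝒬 b k)) (μ b k) (z₀ b k) U (fun z => Fn b k' k (U + z)))
    (h𝒢 : ∀ (b : B.Birth) (k' k : ℕ), B.birthScale b ≤ k' → k' ≤ k → k + 1 ≤ B.K → RanBelow Gate (k + 1) →
      ∀ U, (fun z => Fn b k' k (U + z)) ∈ BddClass F (μ b k))
    (hD : ∀ b k, (D b k).Nonempty) (hϱ : ∀ b k' k, 0 < ϱ b k' k)
    (hB : ∀ (b : B.Birth) (k' k : ℕ), B.birthScale b ≤ k' → k' ≤ k → k + 1 ≤ B.K → RanBelow Gate (k + 1) →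
      RealBaseAt (ref b k) (base b k) (𝒜 b k) (μ b k) (𝒦 b k' (k + 1)))
    (hE : ∀ (b : B.Birth) (k' k : ℕ), B.birthScale b ≤ k' → k' ≤ k → k + 1 ≤ B.K → RanBelow Gate (k + 1) →
      ExponentSliceAt (ref b k) (𝒜 b k) (μ b k) latMove latN (𝒦 b k' (k + 1)) w (ϱ b k' k) (s b k))
    (hP : ∀ (b : B.Birth) (k' k : ℕ), B.birthScale b ≤ k' → k' ≤ k → k + 1 ≤ B.K → RanBelow Gate (k + 1) →
      PertSlice (fun U z => 𝒬 b k U z - q b k U) (μ b k) latMove latN (𝒦 b k' (k + 1)) w (ϱ b k' k) (s₁ b k))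
    (hs : ∀ (b : B.Birth) (k' k : ℕ), B.birthScale b ≤ k' → k' ≤ k → k + 1 ≤ B.K → RanBelow Gate (k + 1) →
      s b k + s₁ b k ≤ 1)
    (hDμ : ∀ b k, ∀ᵐ z ∂μ b k, z ∈ D b k)
    (hN1 : ∀ (b : B.Birth) (k' k : ℕ), B.birthScale b ≤ k' → k' ≤ k → k + 1 ≤ B.K →
      ∀ z ∈ D b k, ∀ U ∈ 𝒦 b k' (k + 1), U + z ∈ 𝒦 b k' k)
    (hN2 : ∀ (b : B.Birth) (k' k : ℕ), B.birthScale b ≤ k' → k' ≤ k → k + 1 ≤ B.K →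
      ∀ U₀ ∈ 𝒦 b k' (k + 1), ∀ p : NDir d R, latN p ≤ wk b k' (k + 1) → ∀ z' ∈ D b k,
        latMove U₀ p 1 + z' ∈ 𝒦 b k' k)
    (hdiam : ∀ b k, ∀ z ∈ D b k, ∀ z' ∈ D b k, ∀ x ν, ‖z x ν - z' x ν‖ ≤ θ b k)
    (hθ : ∀ b k, 0 < θ b k ∧ θ b k ≤ w) (hθwk : ∀ b k' k, θ b k ≤ wk b k' k)
    (hwk : ∀ b k' k, wk b k' k ≤ w) (hwk_anti : ∀ b k' k, wk b k' (k + 1) ≤ wk b k' k)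
    (hdom : ∀ (b : B.Birth) (k' k : ℕ), B.birthScale b ≤ k' → k' ≤ k → k + 1 ≤ B.K →
      Real.exp 3 * (1 + 4 * θ b k / ϱ b k' k) ≤ α k)
    (hinv : ∀ b k' k, GaugeInvariant (rel b k' k) (Fn b k' k))
    (hdefwk : ∀ b k' k, defect b k' k ≤ wk b k' k)
    (hrate : ∀ (b : B.Birth) (k' k : ℕ), B.birthScale b ≤ k' → k' ≤ k → k ≤ B.K →
      defect b k' k ≤ cδ * ψ ^ (k - k'))
    (hlin : ∀ (b : B.Birth) (k' k : ℕ), B.birthScale b ≤ k' → k' ≤ k → k ≤ B.K → RanBelow Gate k → ∀ ε > 0,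
      ∃ U₀ ∈ 𝒦 b k' k, ∃ U₁ : Fld d R, RelGauge (rel b k' k) latMove latN U₀ U₁ (defect b k' k) ∧
        T.lin b k' k ≤ ‖Fn b k' k U₁ - Fn b k' k U₀‖ + ε) :
    T.TransportsFromVar (4 * cδ / r) (fun i => ψ * α i) Gate := by
  have e : ∀ b k, 𝒜 b k + 𝒬 b k = (𝒜 b k + fun U z => 𝒬 b k U z - q b k U) + fun U _ => q b k U := fun b k => by
    funext U z
    simp only [Pi.add_apply]
    ring
  have hFn' : ∀ (b : B.Birth) (k' k : ℕ), B.birthScale b ≤ k' → k' ≤ k → k + 1 ≤ B.K → RanBelow Gate (k + 1) →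
      ∀ U, Fn b k' (k + 1) U =
        wOp (expWeight (base b k) (𝒜 b k + fun U z => 𝒬 b k U z - q b k U)) (μ b k) (z₀ b k) U
          (fun z => Fn b k' k (U + z)) := by
    intro b k' k h₁ h₂ h₃ h₄ U
    rw [hFn b k' k h₁ h₂ h₃ h₄ U, e b k, wOp_expWeight_add_zconst]
  exact transportsFromVar_of_linearOpSlicesOn_lattice_fam_win (𝒢 := fun b k => BddClass F (μ b k))
    (E := fun b k => wOp (expWeight (base b k) (𝒜 b k + fun U z => 𝒬 b k U z - q b k U)) (μ b k) (z₀ b k))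
    (a := fun _ _ => Real.exp 3) (ϱ := ϱ) (θ := θ)
    hα hr hw hsl hFn' h𝒢 hD hϱ (fun b k c => const_mem_bddClass (μ b k) c)
    (fun b k _ hg _ hg' => sub_mem_bddClass hg hg')
    (fun b k U _ hg _ hg' => wOp_sub _ (μ b k) (z₀ b k) U hg hg')
    (fun b k U c => wOp_const _ (μ b k) (z₀ b k) U c)
    (fun b k' k hbk' hk'k hk hran =>
      opSliceOn_mono_const (hD b k)
        (opSliceOn_wOp_dressed (z₀ b k) (hB b k' k hbk' hk'k hk hran) (hE b k' k hbk' hk'k hk hran)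
          (hP b k' k hbk' hk'k hk hran) (hs b k' k hbk' hk'k hk hran) (hDμ b k))
        (Real.exp_le_exp.mpr (by linarith [hs b k' k hbk' hk'k hk hran])))
    hN1 hN2 hdiam hθ hθwk hwk hwk_anti hdom hinv hdefwk hrate hlin

end PerWindowLattice

end

end Summit.QuantumFields.BalabanUV.T4Continuum.T4TrajectoryDensityDressed
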